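import Mathlib
import HarnessLib

/-!
# Knauf (1998), Sect. 6: the graphs `G_d` on the `M₊`/`M₋`-orbits of `SL(2,ℤ/dℤ)`, adjacency eigenvalues,
# the bipartite Ramanujan property, and Knauf's conjecture

Source: A. Knauf, *The number-theoretical spin chain and the Riemann zeroes*, Comm. Math. Phys. **196** (1998)
703–731, doi:10.1007/s002200050441 [Knauf1998], Sect. 6 (Definitions 12, 13 and the Conjecture stated after them);
restated in A. Knauf, *Number theory, dynamical systems and statistical mechanics*, Rev. Math. Phys. **11** (1999)
1027–1060, §4.  (The 2001 H21 study cites [Knauf1998] after the author's preprint "To appear in CMP (1998)", 35 pp., and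
uses THAT version's numbering — Def. 12/13, matrices (47).)  PROVENANCE FLAG: the primary text is paywalled and was
NOT re-read by the producing system (cite-only, acquisition request acq-01352); the statement below is the
transcription of the 2001 H21 study (archive `summits/rh/routes/knauf-spin-chain-ramanujan/paper/paper.tex`,
ll. 121–127 and Definition 2.4 = ll. 363–372, "the matrices (47) of [Kn98]"), corroborated by the sequel A. Knauf,
*Spectral gaps for the number-theoretical spin chain* (arXiv:1305.6410, 2015), §2.4.1 and Prop. 2.12 (same graphs:
vertex classes = orbits of `−R⁻¹L = [[-1,-1],[1,0]]` and of `−LR⁻¹`, edge set = the group; three-regular for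
`n ≥ 3`, connected for odd `n`).

The conjecture (verbatim from the 2001 transcription of [Knauf1998, Sect. 6]; also Knauf 1999, §4).  "The graphs
`G_d` introduced in Def. 12 for `SL(2,ℤ/dℤ)` are bipartite Ramanujan."  Here (Def. 12) for an integer `d ≥ 3`, `G_d`
has vertex set `V = V₊ ⊔ V₋`, `V±` = the set of orbits `{g, M± g, M±² g}` of left multiplication by
`M₊ = [[-1,-1],[1,0]]`, `M₋ = [[-1,1],[-1,0]]` on `SL(2,ℤ/dℤ)`, and edge set `SL(2,ℤ/dℤ)`, the edge `g` joining the
`M₊`-orbit and the `M₋`-orbit of `g`; and (Def. 13, after Lubotzky–Phillips–Sarnak) a finite `k`-regular bipartite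
graph is *bipartite Ramanujan* if `μ_b ≤ 2√(k−1)`, where `μ_b` is the third largest absolute value of an adjacency
eigenvalue (`±k` being the two trivial ones).

What is here: `SL2 d` (4-tuples over `ZMod d` with `ad − bc = 1`; `SL2.equivSpecialLinearGroup` identifies it with
Mathlib's `SL(2, ZMod d)`), `mulP`/`mulM` = left multiplication by `M₊`/`M₋` (`SL2.toMat_mulP`, `toMat_mulM`,
`MP_pow_three`, `MM_pow_three`), the orbit relations and the vertex types `VP d`, `VM d`, `V d = VP d ⊕ VM d`, the
graph `G d : SimpleGraph (V d)` — literally Def. 12 —, its bipartition, the neighbourhood lemmas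
`neighborFinset_vP/vM`, the predicate `IsAdjEigenvalue G μ :↔ ∃ f ≠ 0, (G.adjMatrix ℝ) *ᵥ f = μ • f` (equivalently
`Module.End.HasEigenvalue`, lemma `isAdjEigenvalue_iff_hasEigenvalue`), `IsBipartiteRamanujan G k :↔` every
adjacency eigenvalue `μ` has `|μ| = k` or `|μ| ≤ 2√(k−1)` — the WEAKEST reading of Def. 13 (it ignores multiplicities
and does not even ask `G` to be `k`-regular, bipartite or connected; the multiplicity reading and the per-component
reading both IMPLY it, so its failure refutes the conjecture under every reading) —, and
`AllGdBipartiteRamanujan := ∀ d ≥ 3, IsBipartiteRamanujan (G d) 3` (the source calls it a Conjecture; bundle name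
`KnaufConjecture`) — a published statement REFUTED in this tree (`Literature.MathematicalPhysics.StatisticalMechanics.Knauf1998.allGdBipartiteRamanujan_false`, module
`Eigenvalue`, at `d = 15`); it is kept as a cited definition only because its refutation names it, and is NOT
literature debt: no `AllGdBipartiteRamanujan_holds` can exist.  Modelling remarks: right multiplication, or `M±⁻¹` in place of `M±`, give
isomorphic graphs via `g ↦ g⁻¹`, resp. the same orbits.

Provenance: refutations bundle `papers/_cross/refutations` (H21 seat pub-refute-2, 2026-08-18), package module
`Refutations.Knauf1998 (§§ SL2 … KnaufConjecture)`, moved into the tree under the Lean-in-tree rule (human 2026-08-18); the eigenvector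
table was GENERATED by that bundle's `tools/knauf_g15_gen.py` (pure Python, exact arithmetic; `--check` re-derives the
data file byte-for-byte) from the 2001 H21 study (archive `summits/rh/routes/knauf-spin-chain-ramanujan`).

NOT here: the `d = 15` computation and the refutation (`Transport`, `Eigenvalue`), connectedness, the spin chain.
-/

namespace Literature.MathematicalPhysics.StatisticalMechanics.Knauf1998

variable {d : ℕ}

/-! ## `SL(2, ℤ/dℤ)` as 4-tuples, and Knauf's `M₊`, `M₋` -/

/-- `SL(2, ℤ/dℤ)`: 4-tuples `(a, b, c, d)` over `ZMod d` — the matrix `[[a, b], [c, d]]` — with `ad − bc = 1`. [folklore] -/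
def SL2 (d : ℕ) : Type :=
  {t : ZMod d × ZMod d × ZMod d × ZMod d // t.1 * t.2.2.2 - t.2.1 * t.2.2.1 = 1}

variable {d : ℕ}

/-- Instance `instDecidableEqSL2`: `: DecidableEq (SL2 d)` (bookkeeping). [folklore] -/
instance instDecidableEqSL2 : DecidableEq (SL2 d) := by unfold SL2; infer_instance

/-- Instance `instFintypeSL2`: `[NeZero d] : Fintype (SL2 d)` (bookkeeping). [folklore] -/
instance instFintypeSL2 [NeZero d] : Fintype (SL2 d) := by unfold SL2; infer_instance

/-- Left multiplication by Knauf's `M₊ = [[-1,-1],[1,0]]`: `[[a,b],[c,d]] ↦ [[-a-c, -b-d], [a, b]]`. [folklore] -/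
def mulP (g : SL2 d) : SL2 d :=
  ⟨(-g.1.1 - g.1.2.2.1, -g.1.2.1 - g.1.2.2.2, g.1.1, g.1.2.1), by
    obtain ⟨⟨a, b, c, e⟩, h⟩ := g
    dsimp only at h ⊢
    linear_combination h⟩

/-- Left multiplication by Knauf's `M₋ = [[-1,1],[-1,0]]`: `[[a,b],[c,d]] ↦ [[-a+c, -b+d], [-a, -b]]`. [folklore] -/
def mulM (g : SL2 d) : SL2 d :=
  ⟨(-g.1.1 + g.1.2.2.1, -g.1.2.1 + g.1.2.2.2, -g.1.1, -g.1.2.1), by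
    obtain ⟨⟨a, b, c, e⟩, h⟩ := g
    dsimp only at h ⊢
    linear_combination h⟩

/-- Auxiliary lemma: `(g : SL2 d) : mulP (mulP (mulP g)) = g`. [folklore] -/
@[simp] theorem mulP_mulP_mulP (g : SL2 d) : mulP (mulP (mulP g)) = g := by
  obtain ⟨⟨a, b, c, e⟩, h⟩ := g
  apply Subtype.ext
  simp only [mulP, Prod.mk.injEq]
  refine ⟨?_, ?_, ?_, ?_⟩ <;> ring

/-- Auxiliary lemma: `(g : SL2 d) : mulM (mulM (mulM g)) = g`. [folklore] -/
@[simp] theorem mulM_mulM_mulM (g : SL2 d) : mulM (mulM (mulM g)) = g := by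
  obtain ⟨⟨a, b, c, e⟩, h⟩ := g
  apply Subtype.ext
  simp only [mulM, Prod.mk.injEq]
  refine ⟨?_, ?_, ?_, ?_⟩ <;> ring

namespace SL2

/-- The matrix `[[a,b],[c,d]]` of an element. [folklore] -/
def toMat (g : SL2 d) : Matrix (Fin 2) (Fin 2) (ZMod d) := !![g.1.1, g.1.2.1; g.1.2.2.1, g.1.2.2.2]

/-- Auxiliary lemma: `(g : SL2 d) : (toMat g).det = 1`. [folklore] -/
theorem det_toMat (g : SL2 d) : (toMat g).det = 1 := by
  rw [toMat, Matrix.det_fin_two_of]; exact g.2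

/-- `SL2 d` is Mathlib's `SL(2, ℤ/dℤ)` (`Matrix.SpecialLinearGroup (Fin 2) (ZMod d)`), entry by entry. [folklore] -/
def equivSpecialLinearGroup : SL2 d ≃ Matrix.SpecialLinearGroup (Fin 2) (ZMod d) where
  toFun g := ⟨toMat g, det_toMat g⟩
  invFun A := ⟨(A.1 0 0, A.1 0 1, A.1 1 0, A.1 1 1), by
    have h := A.2
    rw [Matrix.det_fin_two] at h
    simpa using h⟩
  left_inv g := by
    obtain ⟨⟨a, b, c, e⟩, h⟩ := g
    apply Subtype.ext
    simp [toMat]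
  right_inv A := by
    apply Subtype.ext
    ext i j
    fin_cases i <;> fin_cases j <;> simp [toMat]

/-- Auxiliary lemma: `(g : SL2 d) : (equivSpecialLinearGroup g).1 = toMat g`. [folklore] -/
@[simp] theorem equivSpecialLinearGroup_apply (g : SL2 d) : (equivSpecialLinearGroup g).1 = toMat g := rfl

/-- Knauf's `M₊ = [[-1,-1],[1,0]]` (the matrix (47) of [Knauf1998]; `= −R⁻¹L` in (Knauf 2015, arXiv:1305.6410)). [cite: Knauf1998, Sect. 6 (47)] -/
def MP : Matrix (Fin 2) (Fin 2) (ZMod d) := !![-1, -1; 1, 0]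

/-- Knauf's `M₋ = [[-1,1],[-1,0]]`. [cite: Knauf1998, Sect. 6 (47)] -/
def MM : Matrix (Fin 2) (Fin 2) (ZMod d) := !![-1, 1; -1, 0]

/-- Auxiliary lemma: `{α : Type*} {a b c e a' b' c' e' : α} (h₁ : a = a') (h₂ : b = b') (h₃ : c = c') (h₄ : e = e') : !![a, b; c, e] = !![a', b'; c', e']`. [folklore] -/
private theorem mat_eq {α : Type*} {a b c e a' b' c' e' : α} (h₁ : a = a') (h₂ : b = b') (h₃ : c = c')
    (h₄ : e = e') : !![a, b; c, e] = !![a', b'; c', e'] := by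
  subst h₁ h₂ h₃ h₄; rfl

/-- `mulP` IS left multiplication by `M₊`. [folklore] -/
theorem toMat_mulP (g : SL2 d) : toMat (mulP g) = MP * toMat g := by
  obtain ⟨⟨a, b, c, e⟩, h⟩ := g
  simp only [toMat, mulP, MP, Matrix.mul_fin_two]
  exact mat_eq (by ring) (by ring) (by ring) (by ring)

/-- `mulM` IS left multiplication by `M₋`. [folklore] -/
theorem toMat_mulM (g : SL2 d) : toMat (mulM g) = MM * toMat g := by
  obtain ⟨⟨a, b, c, e⟩, h⟩ := g
  simp only [toMat, mulM, MM, Matrix.mul_fin_two]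
  exact mat_eq (by ring) (by ring) (by ring) (by ring)

/-- Auxiliary lemma: `: (MP : Matrix (Fin 2) (Fin 2) (ZMod d)) ^ 3 = 1`. [folklore] -/
theorem MP_pow_three : (MP : Matrix (Fin 2) (Fin 2) (ZMod d)) ^ 3 = 1 := by
  rw [pow_succ, pow_two, MP, Matrix.mul_fin_two, Matrix.mul_fin_two, Matrix.one_fin_two]
  exact mat_eq (by ring) (by ring) (by ring) (by ring)

/-- Auxiliary lemma: `: (MM : Matrix (Fin 2) (Fin 2) (ZMod d)) ^ 3 = 1`. [folklore] -/
theorem MM_pow_three : (MM : Matrix (Fin 2) (Fin 2) (ZMod d)) ^ 3 = 1 := by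
  rw [pow_succ, pow_two, MM, Matrix.mul_fin_two, Matrix.mul_fin_two, Matrix.one_fin_two]
  exact mat_eq (by ring) (by ring) (by ring) (by ring)

/-- Auxiliary lemma: `: Function.Injective (toMat (d := d))`. [folklore] -/
theorem toMat_injective : Function.Injective (toMat (d := d)) := fun g h e => by
  have := congrArg (fun M : Matrix (Fin 2) (Fin 2) (ZMod d) => (M 0 0, M 0 1, M 1 0, M 1 1)) e
  obtain ⟨⟨a, b, c, e⟩, hg⟩ := g
  obtain ⟨⟨a', b', c', e'⟩, hh⟩ := h
  apply Subtype.ext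
  simpa [toMat] using this

end SL2

/-! ## The orbits and the graph `G d` ([Knauf1998] Def. 12) -/

/-- `h` lies in the `M₊`-orbit `{g, M₊g, M₊²g}` of `g`. [folklore] -/
def RelP (g h : SL2 d) : Prop := h = g ∨ h = mulP g ∨ h = mulP (mulP g)

/-- `h` lies in the `M₋`-orbit `{g, M₋g, M₋²g}` of `g`. [folklore] -/
def RelM (g h : SL2 d) : Prop := h = g ∨ h = mulM g ∨ h = mulM (mulM g)

/-- Decidability / finiteness bookkeeping instance. [folklore] -/
instance (g h : SL2 d) : Decidable (RelP g h) := by unfold RelP; infer_instance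
/-- Decidability / finiteness bookkeeping instance. [folklore] -/
instance (g h : SL2 d) : Decidable (RelM g h) := by unfold RelM; infer_instance

/-- Auxiliary lemma: `: Equivalence (RelP (d := d))`. [folklore] -/
theorem relP_equivalence : Equivalence (RelP (d := d)) where
  refl _ := Or.inl rfl
  symm := by
    rintro g h (rfl | rfl | rfl)
    · exact Or.inl rfl
    · exact Or.inr (Or.inr (by simp))
    · exact Or.inr (Or.inl (by simp))
  trans := by
    rintro g h k (rfl | rfl | rfl) (rfl | rfl | rfl) <;> simp [RelP]

/-- Auxiliary lemma: `: Equivalence (RelM (d := d))`. [folklore] -/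
theorem relM_equivalence : Equivalence (RelM (d := d)) where
  refl _ := Or.inl rfl
  symm := by
    rintro g h (rfl | rfl | rfl)
    · exact Or.inl rfl
    · exact Or.inr (Or.inr (by simp))
    · exact Or.inr (Or.inl (by simp))
  trans := by
    rintro g h k (rfl | rfl | rfl) (rfl | rfl | rfl) <;> simp [RelM]

/-- "Same `M₊`-orbit" as a setoid. [folklore] -/
def setoidP (d : ℕ) : Setoid (SL2 d) := ⟨RelP, relP_equivalence⟩

/-- "Same `M₋`-orbit" as a setoid. [folklore] -/
def setoidM (d : ℕ) : Setoid (SL2 d) := ⟨RelM, relM_equivalence⟩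

/-- `V₊`: the set of `M₊`-orbits. [folklore] -/
def VP (d : ℕ) : Type := Quotient (setoidP d)

/-- `V₋`: the set of `M₋`-orbits. [folklore] -/
def VM (d : ℕ) : Type := Quotient (setoidM d)

/-- The vertex set `V = V₊ ⊔ V₋` of `G_d`. [folklore] -/
def V (d : ℕ) : Type := VP d ⊕ VM d

/-- Instance `instDecidableEqVP`: `: DecidableEq (VP d)` (bookkeeping). [folklore] -/
instance instDecidableEqVP : DecidableEq (VP d) := fun x y =>
  Quotient.recOnSubsingleton₂ (motive := fun x y => Decidable (x = y)) x y fun g h =>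
    decidable_of_iff (RelP g h) ⟨fun r => Quotient.sound r, fun e => Quotient.exact e⟩

/-- Instance `instDecidableEqVM`: `: DecidableEq (VM d)` (bookkeeping). [folklore] -/
instance instDecidableEqVM : DecidableEq (VM d) := fun x y =>
  Quotient.recOnSubsingleton₂ (motive := fun x y => Decidable (x = y)) x y fun g h =>
    decidable_of_iff (RelM g h) ⟨fun r => Quotient.sound r, fun e => Quotient.exact e⟩

/-- Instance `instDecidableEqV`: `: DecidableEq (V d)` (bookkeeping). [folklore] -/
instance instDecidableEqV : DecidableEq (V d) := by unfold V; infer_instance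

/-- Instance `instFintypeVP`: `[NeZero d] : Fintype (VP d)` (bookkeeping). [folklore] -/
instance instFintypeVP [NeZero d] : Fintype (VP d) :=
  Fintype.ofSurjective (Quotient.mk (setoidP d)) fun q => Quotient.inductionOn q fun g => ⟨g, rfl⟩

/-- Instance `instFintypeVM`: `[NeZero d] : Fintype (VM d)` (bookkeeping). [folklore] -/
instance instFintypeVM [NeZero d] : Fintype (VM d) :=
  Fintype.ofSurjective (Quotient.mk (setoidM d)) fun q => Quotient.inductionOn q fun g => ⟨g, rfl⟩

/-- Instance `instFintypeV`: `[NeZero d] : Fintype (V d)` (bookkeeping). [folklore] -/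
instance instFintypeV [NeZero d] : Fintype (V d) := by unfold V; infer_instance

/-- The vertex of `V₊` through `g` (its `M₊`-orbit). [folklore] -/
def vP (g : SL2 d) : V d := Sum.inl (Quotient.mk (setoidP d) g)

/-- The vertex of `V₋` through `g` (its `M₋`-orbit). [folklore] -/
def vM (g : SL2 d) : V d := Sum.inr (Quotient.mk (setoidM d) g)

/-- Auxiliary lemma: `{g h : SL2 d} : vP g = vP h ↔ RelP g h`. [folklore] -/
theorem vP_eq_vP_iff {g h : SL2 d} : vP g = vP h ↔ RelP g h :=
  ⟨fun e => Quotient.exact (Sum.inl_injective e), fun r => congrArg Sum.inl (Quotient.sound r)⟩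

/-- Auxiliary lemma: `{g h : SL2 d} : vM g = vM h ↔ RelM g h`. [folklore] -/
theorem vM_eq_vM_iff {g h : SL2 d} : vM g = vM h ↔ RelM g h :=
  ⟨fun e => Quotient.exact (Sum.inr_injective e), fun r => congrArg Sum.inr (Quotient.sound r)⟩

/-- Auxiliary lemma: `(g h : SL2 d) : vP g ≠ vM h`. [folklore] -/
@[simp] theorem vP_ne_vM (g h : SL2 d) : vP g ≠ vM h := Sum.inl_ne_inr

/-- Auxiliary lemma: `(g h : SL2 d) : vM g ≠ vP h`. [folklore] -/
@[simp] theorem vM_ne_vP (g h : SL2 d) : vM g ≠ vP h := Sum.inr_ne_inl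

/-- Auxiliary lemma: `(x : VP d) : ∃ g : SL2 d, vP g = Sum.inl x`. [folklore] -/
theorem vP_surjective_left (x : VP d) : ∃ g : SL2 d, vP g = Sum.inl x :=
  Quotient.inductionOn x fun g => ⟨g, rfl⟩

/-- Auxiliary lemma: `(y : VM d) : ∃ g : SL2 d, vM g = Sum.inr y`. [folklore] -/
theorem vM_surjective_right (y : VM d) : ∃ g : SL2 d, vM g = Sum.inr y :=
  Quotient.inductionOn y fun g => ⟨g, rfl⟩

/-- **Knauf's graph `G_d`** ([Knauf1998] Def. 12): vertices the `M₊`-orbits and the `M₋`-orbits of `SL(2,ℤ/dℤ)`, the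
edge `g ∈ SL(2,ℤ/dℤ)` joining the `M₊`-orbit of `g` to the `M₋`-orbit of `g`. [cite: Knauf1998, Sect. 6 Def. 12] -/
def G (d : ℕ) : SimpleGraph (V d) where
  Adj x y := ∃ g : SL2 d, (x = vP g ∧ y = vM g) ∨ (x = vM g ∧ y = vP g)
  symm := ⟨by
    rintro x y ⟨g, h | h⟩
    exacts [⟨g, Or.inr ⟨h.2, h.1⟩⟩, ⟨g, Or.inl ⟨h.2, h.1⟩⟩]⟩
  loopless := ⟨by
    rintro x ⟨g, ⟨h₁, h₂⟩ | ⟨h₁, h₂⟩⟩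
    · exact vP_ne_vM g g (h₁.symm.trans h₂)
    · exact vM_ne_vP g g (h₁.symm.trans h₂)⟩

/-- Instance `instDecidableRelAdj`: `[NeZero d] : DecidableRel (G d).Adj` (bookkeeping). [folklore] -/
instance instDecidableRelAdj [NeZero d] : DecidableRel (G d).Adj := fun x y =>
  inferInstanceAs (Decidable (∃ g : SL2 d, (x = vP g ∧ y = vM g) ∨ (x = vM g ∧ y = vP g)))

/-- `G_d` is bipartite with parts `V₊`, `V₋`. [folklore] -/
def bipartition (d : ℕ) : (G d).Coloring Bool :=
  SimpleGraph.Coloring.mk (fun x => x.isLeft) (by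
    rintro x y ⟨g, ⟨rfl, rfl⟩ | ⟨rfl, rfl⟩⟩ <;> simp [vP, vM])

/-- Auxiliary lemma: `(d : ℕ) : (G d).Colorable 2`. [folklore] -/
theorem colorable_two (d : ℕ) : (G d).Colorable 2 := by
  simpa using (bipartition d).colorable

/-- Auxiliary lemma: `{g : SL2 d} {y : V d} : (G d).Adj (vP g) y ↔ y = vM g ∨ y = vM (mulP g) ∨ y = vM (mulP (mulP g))`. [folklore] -/
theorem adj_vP_iff {g : SL2 d} {y : V d} :
    (G d).Adj (vP g) y ↔ y = vM g ∨ y = vM (mulP g) ∨ y = vM (mulP (mulP g)) := by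
  constructor
  · rintro ⟨g', ⟨h₁, h₂⟩ | ⟨h₁, _⟩⟩
    · rw [vP_eq_vP_iff] at h₁
      rcases h₁ with rfl | rfl | rfl
      · exact Or.inl h₂
      · exact Or.inr (Or.inl h₂)
      · exact Or.inr (Or.inr h₂)
    · exact absurd h₁ (vP_ne_vM _ _)
  · rintro (rfl | rfl | rfl)
    · exact ⟨g, Or.inl ⟨rfl, rfl⟩⟩
    · exact ⟨mulP g, Or.inl ⟨vP_eq_vP_iff.2 (Or.inr (Or.inl rfl)), rfl⟩⟩
    · exact ⟨mulP (mulP g), Or.inl ⟨vP_eq_vP_iff.2 (Or.inr (Or.inr rfl)), rfl⟩⟩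

/-- Auxiliary lemma: `{g : SL2 d} {y : V d} : (G d).Adj (vM g) y ↔ y = vP g ∨ y = vP (mulM g) ∨ y = vP (mulM (mulM g))`. [folklore] -/
theorem adj_vM_iff {g : SL2 d} {y : V d} :
    (G d).Adj (vM g) y ↔ y = vP g ∨ y = vP (mulM g) ∨ y = vP (mulM (mulM g)) := by
  constructor
  · rintro ⟨g', ⟨h₁, _⟩ | ⟨h₁, h₂⟩⟩
    · exact absurd h₁ (vM_ne_vP _ _)
    · rw [vM_eq_vM_iff] at h₁
      rcases h₁ with rfl | rfl | rfl
      · exact Or.inl h₂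
      · exact Or.inr (Or.inl h₂)
      · exact Or.inr (Or.inr h₂)
  · rintro (rfl | rfl | rfl)
    · exact ⟨g, Or.inr ⟨rfl, rfl⟩⟩
    · exact ⟨mulM g, Or.inr ⟨vM_eq_vM_iff.2 (Or.inr (Or.inl rfl)), rfl⟩⟩
    · exact ⟨mulM (mulM g), Or.inr ⟨vM_eq_vM_iff.2 (Or.inr (Or.inr rfl)), rfl⟩⟩

/-- The neighbours of the `M₊`-orbit of `g` are the `M₋`-orbits of `g, M₊g, M₊²g`. [folklore] -/
theorem neighborFinset_vP (g : SL2 d) {_hF : Fintype ((G d).neighborSet (vP g))} :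
    (G d).neighborFinset (vP g) = {vM g, vM (mulP g), vM (mulP (mulP g))} := by
  ext y
  simp only [SimpleGraph.mem_neighborFinset, adj_vP_iff, Finset.mem_insert, Finset.mem_singleton]

/-- The neighbours of the `M₋`-orbit of `g` are the `M₊`-orbits of `g, M₋g, M₋²g`. [folklore] -/
theorem neighborFinset_vM (g : SL2 d) {_hF : Fintype ((G d).neighborSet (vM g))} :
    (G d).neighborFinset (vM g) = {vP g, vP (mulM g), vP (mulM (mulM g))} := by
  ext y
  simp only [SimpleGraph.mem_neighborFinset, adj_vM_iff, Finset.mem_insert, Finset.mem_singleton]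

/-! ## Adjacency eigenvalues and the bipartite Ramanujan property ([Knauf1998] Def. 13) -/

open Classical in
/-- `μ` is an adjacency eigenvalue of the finite graph `G`: `A f = μ f` for some `f ≠ 0`, `A` the adjacency matrix. [folklore] -/
def IsAdjEigenvalue {W : Type*} [Fintype W] (G : SimpleGraph W) (μ : ℝ) : Prop :=
  ∃ f : W → ℝ, f ≠ 0 ∧ (G.adjMatrix ℝ).mulVec f = μ • f

open Classical in
/-- The same notion in Mathlib's language of eigenvalues of the linear endomorphism `v ↦ A v` of `ℝ^W`. [folklore] -/
theorem isAdjEigenvalue_iff_hasEigenvalue {W : Type*} [Fintype W] (G : SimpleGraph W) (μ : ℝ) :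
    IsAdjEigenvalue G μ ↔ Module.End.HasEigenvalue (Matrix.toLin' (G.adjMatrix ℝ)) μ := by
  rw [Module.End.hasEigenvalue_iff, Submodule.ne_bot_iff]
  simp only [IsAdjEigenvalue, Module.End.mem_eigenspace_iff, Matrix.toLin'_apply]
  constructor
  · rintro ⟨f, h₁, h₂⟩; exact ⟨f, h₂, h₁⟩
  · rintro ⟨f, h₁, h₂⟩; exact ⟨f, h₂, h₁⟩

/-- **Bipartite Ramanujan** (the weakest reading of [Knauf1998] Def. 13 / LPS for a `k`-regular bipartite graph):
every adjacency eigenvalue `μ` other than the trivial ones `±k` satisfies `|μ| ≤ 2√(k−1)`. [cite: Knauf1998, Sect. 6 Def. 13] -/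
def IsBipartiteRamanujan {W : Type*} [Fintype W] (G : SimpleGraph W) (k : ℕ) : Prop :=
  ∀ μ : ℝ, IsAdjEigenvalue G μ → |μ| = k ∨ |μ| ≤ 2 * √((k : ℝ) - 1)

/-- **Knauf's Sect. 6 assertion** ([Knauf1998] Sect. 6, stated after Def. 13; Knauf 1999, §4): "The graphs `G_d`
introduced in Def. 12 for `SL(2,ℤ/dℤ)` are bipartite Ramanujan" — for every modulus `d ≥ 3` (they are `3`-regular).
**REFUTED as stated, in this tree:** `allGdBipartiteRamanujan_false : ¬ AllGdBipartiteRamanujan` (module `Eigenvalue`,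
`d = 15`, kernel-checked, unconditional).  Kept, statement as transcribed, because its refutation names it; NOT
literature debt — no `AllGdBipartiteRamanujan_holds` can exist. [cite: Knauf1998, Sect. 6 after Def. 13] -/
def AllGdBipartiteRamanujan : Prop :=
  ∀ (d : ℕ) [NeZero d], 3 ≤ d → IsBipartiteRamanujan (G d) 3

end Literature.MathematicalPhysics.StatisticalMechanics.Knauf1998
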